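import Summits.QuantumAdvantage.AdviceFreeQNC0.WalkFailSetHitsEntropy
import Summits.QuantumAdvantage.AdviceFreeQNC0.SPSRingFail
import HarnessLib

/-!
# Route RingFrame, crux α `RingToElim` (stmt-QuantumAdvantage-19119): the SHARP INTERPOLATION FLOOR
# read on the ring in `T10W` shape — every polynomial device of degree `D ≥ D₀(c)` for the
# `(n+1)`-cycle errs on at least `2^{n − cD}` measurement patterns, `n ≥ λD`, for EVERY
# `c > 13 − 5·log₂ 5 ≈ 1.3904`

Support theorem for the crux item α in the language of the rung leaf `RingHard 2`
(`Literature…RingHLF.Rel`): the density-axis statement `RingFailLinearWalk c` of the walk game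
(`AdviceFreeQNC0/WalkFailSetHitsEntropy.lean`, `ringFailLinearWalk_of_entropy_lt`: the sharp
fail-set interpolation bound `#FAIL ≥ 2^{ℓ−m}·N_{D'}(m)`, `m = 2D + 3D' + 3`, of prover
qn-prover-3 gen 6 combined with the largest-term entropy bound `C(m,k) ≥ m^m/((m+1)k^k(m−k)^{m−k})`
at the ratio `k/m = 1/5`) transported through the affine chart of `WalkTransport.lean`
(`hasDeg_transport`; fail counts by `SPSRingFail.card_fail_le_card_not_rel`):

* **`ringRel_fail_entropy`** — for every `c > log₂(8192/3125)` there are `λ, D₀` such that for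
  `D ≥ D₀`, `n ≥ λ·D` and every tuple `P` of `𝔽₂`-polynomials of degree `≤ D` on `{0,1}^{n+1}`,
  the relation `Rel x (P x)` FAILS for at least `2^{−cD}·2ⁿ` patterns `x`.

Ladder of kernel exponents `a` in `#FAIL ≥ 2^{n − aD − o(D)}` on the ring: `2` (fail floor) →
`log₂ 3 + ε` (`RingFrameRingToElimTensorZeroFloor.lean`) → **`1.3904 + ε`** (this file; the
interpolation method's optimum is `≈ 1.3886`).  The cell's bookkeeping (prover qn-prover-3 gen 7);
not in print.  WHAT THIS IS NOT: not a constant-loss bound (`RingHard 2` / α untouched); `T10W`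
(`a < 1`) untouched; no separation claim.
-/

-- the sub-problem namespace `Summit.QuantumAdvantage.QuantumAdvantage` repeats the summit name by design (D-0017)
set_option linter.dupNamespace false

noncomputable section

namespace Summit.QuantumAdvantage.QuantumAdvantage.Theorems

open Finset Summit.QuantumAdvantage.AdviceFreeQNC0
open Literature.Computability.QuantumComplexity Literature.Computability.QuantumComplexity.RingHLF
open Literature.Computability.MetaComplexity Literature.Computability.MetaComplexity.Smolensky

/-- **THE SHARP INTERPOLATION FLOOR ON THE RING, `T10W` SHAPE.**  For every
`c > log₂(8192/3125) ≈ 1.3904` there are `λ D₀ : ℕ` such that for all `D ≥ D₀`, all `n ≥ λ·D` and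
every tuple `P` of `𝔽₂`-polynomials of degree `≤ D` on the patterns of the `(n+1)`-cycle,
`Rel x (P x)` fails for at least `2^{−cD}·2ⁿ` patterns `x`. -/
theorem ringRel_fail_entropy {c : ℝ} (hc : Real.logb 2 (8192 / 3125) < c) :
    ∃ lam D₀ : ℕ, ∀ D ≥ D₀, ∀ n ≥ lam * D, ∀ P : Fin (n + 1) → CubeFn (ZMod 2) (n + 1),
      (∀ i, P i ∈ lowDeg (ZMod 2) (n + 1) D) →
        (2 : ℝ) ^ (-(c * (D : ℝ))) * (2 : ℝ) ^ n ≤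
          ((univ.filter fun x : Fin (n + 1) → Bool => ¬ Rel x (fun i => decide (P i x = 1))).card : ℝ) := by
  classical
  obtain ⟨lam, D₀, h⟩ := ringFailLinearWalk_of_entropy_lt hc
  refine ⟨max lam 2, max D₀ 1, fun D hD n hn P hP => ?_⟩
  have hD₀ : D₀ ≤ D := le_trans (le_max_left _ _) hD
  have hD1 : 1 ≤ D := le_trans (le_max_right _ _) hD
  have hlam : lam * D ≤ n := le_trans (Nat.mul_le_mul_right _ (le_max_left _ _)) hn
  have hn2 : 2 ≤ n := by
    have : 2 * D ≤ n := le_trans (Nat.mul_le_mul_right _ (le_max_right _ _)) hn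
    omega
  set z : (Fin (n + 1) → Bool) → (Fin (n + 1) → Bool) := fun x i => decide (P i x = 1) with hz
  set y : Fin (n + 1) → (Fin n → Bool) → Bool :=
    fun g u => xor (z (xOfU u) g) (tGuess (xOfU u) g) with hy
  have hdeg : ∀ g, HasDeg (y g) D := fun g => hasDeg_transport hD1 (P g) (hP g) g
  -- the walk-game bound and the complement count
  have hwin := h D hD₀ n hlam (n + 2) y hdeg
  have htot : ((univ.filter fun u : Fin n → Bool => ringWinU (n + 2) y u = false).card : ℝ) +
      ((univ.filter fun u : Fin n → Bool => ringWinU (n + 2) y u = true).card : ℝ) = (2 : ℝ) ^ n := by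
    have h' := Finset.card_filter_add_card_filter_not
      (s := (univ : Finset (Fin n → Bool))) (fun u => ringWinU (n + 2) y u = false)
    have e : (univ.filter fun u : Fin n → Bool => ¬ ringWinU (n + 2) y u = false) =
        univ.filter fun u : Fin n → Bool => ringWinU (n + 2) y u = true := by
      refine Finset.filter_congr fun u _ => ?_
      cases ringWinU (n + 2) y u <;> simp
    rw [e, card_univ, Fintype.card_fun, Fintype.card_bool, Fintype.card_fin] at h'
    exact_mod_cast h'
  have hfail : (2 : ℝ) ^ (-(c * (D : ℝ))) * (2 : ℝ) ^ n ≤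
      ((univ.filter fun u : Fin n → Bool => ringWinU (n + 2) y u = false).card : ℝ) := by
    linarith
  have h2 := SPSRingFail.card_fail_le_card_not_rel hn2 z
  exact hfail.trans (by exact_mod_cast h2)

end Summit.QuantumAdvantage.QuantumAdvantage.Theorems

end
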